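import Summits.AtomisticToContinuum.Crystallization.Theses.PricedLinkCensus
import Summits.AtomisticToContinuum.Crystallization.Theorems.PricedLinkCensusStackingHingeOfSupportCore
import Summits.AtomisticToContinuum.Crystallization.Theorems.PricedLinkCensusStackingHingeOfExactStars
import Summits.AtomisticToContinuum.Crystallization.Theorems.PricedLinkCensusStackingHingeRootPowerSums
import Summits.AtomisticToContinuum.Crystallization.Theorems.PricedLinkCensusStackingHingeSimilarStarNormalisation
import Summits.AtomisticToContinuum.Crystallization.Theorems.PricedLinkCensusStackingHingeDilationPinning
import Summits.AtomisticToContinuum.Crystallization.Theorems.PalmUnimodularRigidityLayeredLawsSelectHcpDefs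
import Summits.AtomisticToContinuum.Crystallization.Theorems.ReggeStarCoercivityDefectFreeCrystallizesExactSelectionLaw
import Literature.Geometry.DiscreteGeometry.KissingPatterns
import Literature.Probability.Process.PointStationaryLaw

/-!
# Crux `PricedLinkCensus.StackingHinge` (stmt-AtomisticToContinuum-14993) from the SCALE-FREE SHAPE FLOOR (line `Sketch`, RESHAPE 13, lead c5)

This file lands, as ONE sorry-free composition, the cut of the crux's analytic core proposed by the crux-strategist s1
(`Cruxes/StackingHinge/Lines/virial_shape_ratio.lean`, 2026-08-17) and adopted into the live line `Sketch` by lead c5 (skeleton v37–v40):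
the SUPPORT CORE of lead c4 (`PricedHcpWindowsSupportCore.stub_gscpOfSupportCore`, p145881: "rotated relaxed hcp lies in the support of
every minimising everywhere-good point-stationary hard-core law") follows from ONE law-level statement, the ROBUST SCALE-FREE SHAPE FLOOR
`ShapeRatioFloor` (hypothesis `hV2` below, VERBATIM the registered stub `stub_shapeRatioFloor`):
    `S₆(P)² + κ·θ²·P(Bad_θ)·S₁₂(P) ≤ (−24·hcpE a₀ h₀)·S₁₂(P)`   for every law of the crux's dilation-invariant class and every `θ ∈ (0,1]`,
where `S_k(P) = ∫∫‖y‖⁻ᵏ dμ dP` are the root power sums and `Bad_θ` says that the root star is not two-way `(θt)`-matched to a similar copy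
`t·A(F)` of a two-type reference star.  THE LEVER is the virial (optimal-dilation) identity for Palm laws: with `E_P[h] = S₁₂/24 − S₆/12`
(V1) one has `E_P[h] − hcpE = (S₁₂−S₆)²/(24S₁₂) + (Φ*−Φ(P))/24`, `Φ = S₆²/S₁₂`, `Φ* = −24·hcpE(a₀,h₀)`, so `E_P[h] ≤ hcpE` and the floor
make every similarity-bad root-star event `P`-null (`phiStar_mul_le_sq`, AM–GM).  Everything after that is LANDED:
* V1 `PricedHcpWindowsRootPowerSums.stub_rootPowerSums` (p168935): the energy splits into the two root power sums, `S₁₂ > 0`;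
* Aldous–Lyons `ae_forall_map_sub_of_ae`: the matched-at-every-tolerance root star is carried to every point;
* V3 `PricedHcpWindowsSimilarStarNormalisation.stub_similarStarNormalisation` (p170210): ONE dilation `t`, and absolute exact two-type stars
  for `t⁻¹ • S`;
* V4/V5 `PricedHcpWindowsExactStars.exactStarRigidity` (p164240/p168022/p168387; Hales's layer theorem): an exact rotated Barlow stacking,
  `h ∈ {h₀, a₀√(2/3)}`;
* V6 `PricedHcpWindowsDilationPinning.stub_dilationPinning` (p171030): the dilation is `1` under `E_P[h] ≤ hcpE a₀ h₀`;
* X3 `PalmGoodLaw.ExactSelectionLaw.stub_exactSelectionLaw` (crux 13603): selection at exact geometry — a.s. `count|(A '' hcpStacking a₀ h₀)`;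
* an a.s. event of a probability law is non-null and an exact rotated net is two-way `θ`-matched at every `(R, θ)` (tail of c4/c5).
Main results: `supportCore_of_shapeRatioFloor : ShapeRatioFloor → SupportCore`, the registered glue stub
`stub_stackingHingeOfShapeRatioFloor : ShapeRatioFloor → SoftLayerPropagation → ChargeFreeWindows → GroundStatesChargePeriodic` (the crux
with its definition unfolded) and the ONE-LINE CLOSER `stackingHinge_of_shapeRatioFloor : ShapeRatioFloor → StackingHinge`.  All `[folklore]`.
-/

noncomputable section

namespace Summit.AtomisticToContinuum.Crystallization.Theorems.PricedHcpWindowsShapeRatioFloor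

open Literature.MathematicalPhysics.StatisticalMechanics
open Literature.Geometry.DiscreteGeometry
open Literature.Probability.Process
open Summit.AtomisticToContinuum.Crystallization.Theses.PricedLinkCensus
open Summit.AtomisticToContinuum.Crystallization.Theorems
open Summit.AtomisticToContinuum.Crystallization.Theorems.PalmUnimodularRigidity
  (ae_forall_map_sub_of_ae count_restrict_floorNorm_preimage_lt_top)
open Summit.AtomisticToContinuum.Crystallization.Theorems.PricedHcpWindowsAllPointsOfRoot (eq_of_count_restrict_eq)
open Filter Topology MeasureTheory Set

/-- **The virial algebra.**  From `E = S₁₂/24 − S₆/12`, `E ≤ L` and `S₁₂ > 0`: `(−24·L)·S₁₂ ≤ S₆²` (AM–GM on `2S₆ ≥ S₁₂ + (−24L)`).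
[folklore] -/
theorem phiStar_mul_le_sq {E S6 S12 L : ℝ} (hE : E = S12 / 24 - S6 / 12) (hle : E ≤ L) (hS12 : 0 < S12) :
    (-24 * L) * S12 ≤ S6 ^ 2 := by
  have h2 : S12 + (-24 * L) ≤ 2 * S6 := by linarith
  rcases le_or_gt (-24 * L) 0 with hneg | hpos
  · nlinarith [sq_nonneg S6]
  · have hS6 : 0 ≤ S6 := by linarith
    nlinarith [sq_nonneg (S12 - (-24 * L)), h2, hS6, hpos]

/-- **The support core from the shape floor.**  `ShapeRatioFloor` (hypothesis `hV2`, verbatim the registered stub `stub_shapeRatioFloor`)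
implies lead c4's SUPPORT CORE (conclusion, verbatim the statement of v32's `stub_slpLawSupportCore`): V1 + `hV2` + `E ≤ hcpE` null every
similarity-bad root-star event (`phiStar_mul_le_sq`); Aldous–Lyons to every point; V3; exact-star rigidity; V6; X3; a.s.-event tail.
[folklore] -/
theorem supportCore_of_shapeRatioFloor : (∀ a₀ h₀ : ℝ, 189 / 200 ≤ a₀ → a₀ ≤ 199 / 200 → 77 / 100 ≤ h₀ → h₀ ≤ 163 / 200 → (∀ a h : ℝ, 0 < a → 0 < h → Summit.AtomisticToContinuum.Crystallization.Theorems.PalmUnimodularRigidity.LayeredLawsSelectHcp.hcpE a₀ h₀ ≤ Summit.AtomisticToContinuum.Crystallization.Theorems.PalmUnimodularRigidity.LayeredLawsSelectHcp.hcpE a h) → ∀ δ : ℝ, 0 < δ → ∃ κ : ℝ, 0 < κ ∧ ∀ P : MeasureTheory.Measure (MeasureTheory.Measure (EuclideanSpace ℝ (Fin 3))), MeasureTheory.IsProbabilityMeasure P → (∀ᵐ μ ∂P, (∃ S : Set (EuclideanSpace ℝ (Fin 3)), (0 : EuclideanSpace ℝ (Fin 3)) ∈ S ∧ (∀ x ∈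 S, ∀ y ∈ S, x ≠ y → δ ≤ dist x y) ∧ μ = (MeasureTheory.Measure.count : MeasureTheory.Measure (EuclideanSpace ℝ (Fin 3))).restrict S)) → (∀ g : MeasureTheory.Measure (EuclideanSpace ℝ (Fin 3)) → EuclideanSpace ℝ (Fin 3) → ENNReal, Measurable (Function.uncurry g) → ∫⁻ μ, ∫⁻ y, g μ y ∂μ ∂P = ∫⁻ μ, ∫⁻ y, g (MeasureTheory.Measure.map (fun z => z - y) μ) (-y) ∂μ ∂P) → (∀ᵐ μ ∂P, ∃ S : Set (EuclideanSpace ℝ (Fin 3)), μ = (MeasureTheory.Measure.count : MeasureTheory.Measure (EuclideanSpace ℝ (Fin 3))).restrict S ∧ ∀ x ∈ S, (∀ t r : ℝ, Metric.infDist x (S \ {x}) / 6 < t → r < 3 * Metric.infDist x (S \ {x}) → ∃ s : ℤ → ℤ, Literature.MathematicalPhysics.StatisticalMechanics.IsHaggSeq s ∧ ∃ g : EuclideanSpace ℝ (Fin 3) ≃ᵃⁱ[ℝ] EuclideanSpace ℝ (Fin 3), (∀ y ∈ S, dist x y ≤ r → ∃ z ∈ Literature.MathematicalPhysics.StatisticalMechanics.barlowStacking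 (Metric.infDist x (S \ {x})) (Metric.infDist x (S \ {x}) * Real.sqrt (2 / 3)) s, dist y (g z) ≤ t) ∧ (∀ z ∈ Literature.MathematicalPhysics.StatisticalMechanics.barlowStacking (Metric.infDist x (S \ {x})) (Metric.infDist x (S \ {x}) * Real.sqrt (2 / 3)) s, dist x (g z) ≤ r → ∃ y ∈ S, dist y (g z) ≤ t)) ∧ ((∀ y ∈ S, y ≠ x → dist x y < 107 / 100 * Metric.infDist x (S \ {x}) → dist x y ≤ 101 / 100 * Metric.infDist x (S \ {x})) ∧ ∃ T : Finset (EuclideanSpace ℝ (Fin 3)), (↑T : Set (EuclideanSpace ℝ (Fin 3))) ⊆ {y : EuclideanSpace ℝ (Fin 3) | y ∈ S ∧ y ≠ x ∧ dist x y ≤ 101 / 100 * Metric.infDist x (S \ {x})} ∧ T.card = 12)) → ∀ θ : ℝ, 0 < θ → θ ≤ 1 → (∫ μ, (∫ y, (‖y‖⁻¹) ^ 6 ∂μ) ∂P) ^ 2 + κ * θ ^ 2 * (P {μ | ∃ S : Set (EuclideanSpace ℝ (Fin 3)), μ = (MeasureTheory.Measure.count : MeasureTheory.Measure (EuclideanSpace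 ℝ (Fin 3))).restrict S ∧ ¬ (∃ A : EuclideanSpace ℝ (Fin 3) ≃ₗᵢ[ℝ] EuclideanSpace ℝ (Fin 3), ∃ t : ℝ, 0 < t ∧ ∃ F : Set (EuclideanSpace ℝ (Fin 3)), (F = (↑(Summit.AtomisticToContinuum.Crystallization.Theorems.PalmUnimodularRigidity.LayeredLawsSelectHcp.refStar a₀ h₀) : Set (EuclideanSpace ℝ (Fin 3))) ∨ F = ((fun p : EuclideanSpace ℝ (Fin 3) => a₀ • p) '' (↑Literature.Geometry.DiscreteGeometry.fccKissingPattern : Set (EuclideanSpace ℝ (Fin 3))))) ∧ (∀ y ∈ {y : EuclideanSpace ℝ (Fin 3) | y ∈ S ∧ y ≠ 0 ∧ ‖y‖ ≤ 101 / 100 * Metric.infDist (0 : EuclideanSpace ℝ (Fin 3)) (S \ {0})}, ∃ v ∈ F, dist y (t • A v) ≤ θ * t) ∧ (∀ v ∈ F, ∃ y ∈ {y : EuclideanSpace ℝ (Fin 3) | y ∈ S ∧ y ≠ 0 ∧ ‖y‖ ≤ 101 / 100 * Metric.infDist (0 : EuclideanSpace ℝ (Fin 3)) (S \ {0})}, dist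 y (t • A v) ≤ θ * t))}).toReal * (∫ μ, (∫ y, (‖y‖⁻¹) ^ 12 ∂μ) ∂P) ≤ (-24 * Summit.AtomisticToContinuum.Crystallization.Theorems.PalmUnimodularRigidity.LayeredLawsSelectHcp.hcpE a₀ h₀) * (∫ μ, (∫ y, (‖y‖⁻¹) ^ 12 ∂μ) ∂P)) → (∀ a₀ h₀ : ℝ, 189 / 200 ≤ a₀ → a₀ ≤ 199 / 200 → 77 / 100 ≤ h₀ → h₀ ≤ 163 / 200 → (∀ a h : ℝ, 0 < a → 0 < h → Summit.AtomisticToContinuum.Crystallization.Theorems.PalmUnimodularRigidity.LayeredLawsSelectHcp.hcpE a₀ h₀ ≤ Summit.AtomisticToContinuum.Crystallization.Theorems.PalmUnimodularRigidity.LayeredLawsSelectHcp.hcpE a h) → ∀ δ : ℝ, 0 < δ → ∀ P : MeasureTheory.Measure (MeasureTheory.Measure (EuclideanSpace ℝ (Fin 3))), MeasureTheory.IsProbabilityMeasure P → (∀ᵐ μ ∂P, (∃ S : Set (EuclideanSpace ℝ (Fin 3)), (0 : EuclideanSpace ℝ (Fin 3)) ∈ S ∧ (∀ x ∈ S, ∀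 y ∈ S, x ≠ y → δ ≤ dist x y) ∧ μ = (MeasureTheory.Measure.count : MeasureTheory.Measure (EuclideanSpace ℝ (Fin 3))).restrict S)) → (∀ g : MeasureTheory.Measure (EuclideanSpace ℝ (Fin 3)) → EuclideanSpace ℝ (Fin 3) → ENNReal, Measurable (Function.uncurry g) → ∫⁻ μ, ∫⁻ y, g μ y ∂μ ∂P = ∫⁻ μ, ∫⁻ y, g (MeasureTheory.Measure.map (fun z => z - y) μ) (-y) ∂μ ∂P) → (∀ᵐ μ ∂P, ∃ S : Set (EuclideanSpace ℝ (Fin 3)), μ = (MeasureTheory.Measure.count : MeasureTheory.Measure (EuclideanSpace ℝ (Fin 3))).restrict S ∧ ∀ x ∈ S, (∀ t r : ℝ, Metric.infDist x (S \ {x}) / 6 < t → r < 3 * Metric.infDist x (S \ {x}) → ∃ s : ℤ → ℤ, Literature.MathematicalPhysics.StatisticalMechanics.IsHaggSeq s ∧ ∃ g : EuclideanSpace ℝ (Fin 3) ≃ᵃⁱ[ℝ] EuclideanSpace ℝ (Fin 3), (∀ y ∈ S, dist x y ≤ r → ∃ z ∈ Literature.MathematicalPhysics.StatisticalMechanics.barlowStacking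 (Metric.infDist x (S \ {x})) (Metric.infDist x (S \ {x}) * Real.sqrt (2 / 3)) s, dist y (g z) ≤ t) ∧ (∀ z ∈ Literature.MathematicalPhysics.StatisticalMechanics.barlowStacking (Metric.infDist x (S \ {x})) (Metric.infDist x (S \ {x}) * Real.sqrt (2 / 3)) s, dist x (g z) ≤ r → ∃ y ∈ S, dist y (g z) ≤ t)) ∧ ((∀ y ∈ S, y ≠ x → dist x y < 107 / 100 * Metric.infDist x (S \ {x}) → dist x y ≤ 101 / 100 * Metric.infDist x (S \ {x})) ∧ ∃ T : Finset (EuclideanSpace ℝ (Fin 3)), (↑T : Set (EuclideanSpace ℝ (Fin 3))) ⊆ {y : EuclideanSpace ℝ (Fin 3) | y ∈ S ∧ y ≠ x ∧ dist x y ≤ 101 / 100 * Metric.infDist x (S \ {x})} ∧ T.card = 12)) → (∀ᵐ μ ∂P, ∃ S : Set (EuclideanSpace ℝ (Fin 3)), μ = (MeasureTheory.Measure.count : MeasureTheory.Measure (EuclideanSpace ℝ (Fin 3))).restrict S ∧ ∀ x ∈ S, ((∀ y ∈ S, dist x y ≤ 2 * Metric.infDist x (S \ {x}) → 13 / 20 *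 Metric.infDist x (S \ {x}) ≤ Metric.infDist y (S \ {y})) ∧ (∀ y ∈ S, y ≠ x → dist x y ≤ 101 / 100 * Metric.infDist x (S \ {x}) → dist x y ≤ 101 / 100 * Metric.infDist y (S \ {y})) ∧ ({y : EuclideanSpace ℝ (Fin 3) | y ∈ S ∧ y ≠ x ∧ dist x y ≤ 101 / 100 * Metric.infDist x (S \ {x})}.ncard = 12) ∧ (∀ t r : ℝ, Metric.infDist x (S \ {x}) / 6 < t → t ≤ 7 / 40 * Metric.infDist x (S \ {x}) → 29 / 10 * Metric.infDist x (S \ {x}) ≤ r → ∀ (s : ℤ → ℤ) (g : EuclideanSpace ℝ (Fin 3) ≃ᵃⁱ[ℝ] EuclideanSpace ℝ (Fin 3)), Literature.MathematicalPhysics.StatisticalMechanics.IsHaggSeq s → (∀ y ∈ S, dist x y ≤ r → ∃ z ∈ Literature.MathematicalPhysics.StatisticalMechanics.barlowStacking (Metric.infDist x (S \ {x})) (Metric.infDist x (S \ {x}) * Real.sqrt (2 / 3)) s, dist y (g z) ≤ t) → (∀ z ∈ Literature.MathematicalPhysics.StatisticalMechanics.barlowStacking (Metric.infDist x (S \ {x}))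 (Metric.infDist x (S \ {x}) * Real.sqrt (2 / 3)) s, dist x (g z) ≤ r → ∃ y ∈ S, dist y (g z) ≤ t) → ∀ y ∈ S, ∀ y' ∈ S, y ≠ x → dist x y ≤ 101 / 100 * Metric.infDist x (S \ {x}) → y' ≠ x → dist x y' ≤ 101 / 100 * Metric.infDist x (S \ {x}) → y ≠ y' → ∀ z ∈ Literature.MathematicalPhysics.StatisticalMechanics.barlowStacking (Metric.infDist x (S \ {x})) (Metric.infDist x (S \ {x}) * Real.sqrt (2 / 3)) s, ∀ z' ∈ Literature.MathematicalPhysics.StatisticalMechanics.barlowStacking (Metric.infDist x (S \ {x})) (Metric.infDist x (S \ {x}) * Real.sqrt (2 / 3)) s, dist y (g z) ≤ t → dist y' (g z') ≤ t → (dist y y' ≤ 101 / 100 * Metric.infDist y (S \ {y}) ↔ dist z z' = Metric.infDist x (S \ {x}))))) → (∫ μ, (∫ y, Literature.MathematicalPhysics.StatisticalMechanics.lennardJones ‖y‖ ∂μ) / 2 ∂P) ≤ Summit.AtomisticToContinuum.Crystallization.Theorems.PalmUnimodularRigidity.LayeredLawsSelectHcp.hcpE a₀ h₀ → (∀ Q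 : Literature.MathematicalPhysics.StatisticalMechanics.PeriodicConfiguration 3, (∫ μ, (∫ y, Literature.MathematicalPhysics.StatisticalMechanics.lennardJones ‖y‖ ∂μ) / 2 ∂P) ≤ Q.energyPerParticle Literature.MathematicalPhysics.StatisticalMechanics.lennardJones) → ∀ R θ : ℝ, 0 < R → 0 < θ → P {μ | ∃ S : Set (EuclideanSpace ℝ (Fin 3)), μ = (MeasureTheory.Measure.count : MeasureTheory.Measure (EuclideanSpace ℝ (Fin 3))).restrict S ∧ ∃ A : EuclideanSpace ℝ (Fin 3) ≃ₗᵢ[ℝ] EuclideanSpace ℝ (Fin 3), (∀ y ∈ S, ‖y‖ ≤ R → ∃ z ∈ Literature.MathematicalPhysics.StatisticalMechanics.hcpStacking a₀ h₀, dist y (A z) ≤ θ) ∧ (∀ z ∈ Literature.MathematicalPhysics.StatisticalMechanics.hcpStacking a₀ h₀, ‖z‖ ≤ R → ∃ y ∈ S, dist y (A z) ≤ θ)} ≠ 0) := by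
  intro hV2 a₀ h₀ hb1 hb2 hb3 hb4 hglob δ hδ P hP hcore hstat hgood _hLS hle _hper R θ _hR hθ
  obtain ⟨κ, hκ, hfloor⟩ := hV2 a₀ h₀ hb1 hb2 hb3 hb4 hglob δ hδ
  obtain ⟨hE, hS12⟩ := PricedHcpWindowsRootPowerSums.stub_rootPowerSums δ hδ P hP hcore hgood
  have hsq := phiStar_mul_le_sq hE hle hS12
  -- every similarity-bad root-star event is `P`-null
  have hnull : ∀ n : ℕ, P {μ | ∃ S : Set (EuclideanSpace ℝ (Fin 3)), μ = (MeasureTheory.Measure.count : MeasureTheory.Measure (EuclideanSpace ℝ (Fin 3))).restrict S ∧ ¬ (∃ A : EuclideanSpace ℝ (Fin 3) ≃ₗᵢ[ℝ] EuclideanSpace ℝ (Fin 3), ∃ t : ℝ, 0 < t ∧ ∃ F : Set (EuclideanSpace ℝ (Fin 3)), (F = (↑(Summit.AtomisticToContinuum.Crystallization.Theorems.PalmUnimodularRigidity.LayeredLawsSelectHcp.refStar a₀ h₀) : Set (EuclideanSpace ℝ (Fin 3))) ∨ F = ((fun p : EuclideanSpace ℝ (Fin 3) => a₀ • p) '' (↑Literature.Geometry.DiscreteGeometry.fccKissingPattern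 : Set (EuclideanSpace ℝ (Fin 3))))) ∧ (∀ y ∈ {y : EuclideanSpace ℝ (Fin 3) | y ∈ S ∧ y ≠ 0 ∧ ‖y‖ ≤ 101 / 100 * Metric.infDist (0 : EuclideanSpace ℝ (Fin 3)) (S \ {0})}, ∃ v ∈ F, dist y (t • A v) ≤ 1 / ((n : ℝ) + 1) * t) ∧ (∀ v ∈ F, ∃ y ∈ {y : EuclideanSpace ℝ (Fin 3) | y ∈ S ∧ y ≠ 0 ∧ ‖y‖ ≤ 101 / 100 * Metric.infDist (0 : EuclideanSpace ℝ (Fin 3)) (S \ {0})}, dist y (t • A v) ≤ 1 / ((n : ℝ) + 1) * t))} = 0 := by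
    intro n
    have hθ' : (0 : ℝ) < 1 / ((n : ℝ) + 1) := by positivity
    have hθ1 : 1 / ((n : ℝ) + 1) ≤ 1 := by
      rw [div_le_one (by positivity)]
      linarith [n.cast_nonneg (α := ℝ)]
    have hfl := hfloor P hP hcore hstat hgood _ hθ' hθ1
    have h3 : (P {μ | ∃ S : Set (EuclideanSpace ℝ (Fin 3)), μ = (MeasureTheory.Measure.count : MeasureTheory.Measure (EuclideanSpace ℝ (Fin 3))).restrict S ∧ ¬ (∃ A : EuclideanSpace ℝ (Fin 3) ≃ₗᵢ[ℝ] EuclideanSpace ℝ (Fin 3), ∃ t : ℝ, 0 < t ∧ ∃ F : Set (EuclideanSpace ℝ (Fin 3)), (F = (↑(Summit.AtomisticToContinuum.Crystallization.Theorems.PalmUnimodularRigidity.LayeredLawsSelectHcp.refStar a₀ h₀) : Set (EuclideanSpace ℝ (Fin 3))) ∨ F = ((fun p : EuclideanSpace ℝ (Fin 3) => a₀ • p) '' (↑Literature.Geometry.DiscreteGeometry.fccKissingPattern : Set (EuclideanSpace ℝ (Fin 3))))) ∧ (∀ y ∈ {y : EuclideanSpace ℝ (Fin 3) | y ∈ S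 ∧ y ≠ 0 ∧ ‖y‖ ≤ 101 / 100 * Metric.infDist (0 : EuclideanSpace ℝ (Fin 3)) (S \ {0})}, ∃ v ∈ F, dist y (t • A v) ≤ 1 / ((n : ℝ) + 1) * t) ∧ (∀ v ∈ F, ∃ y ∈ {y : EuclideanSpace ℝ (Fin 3) | y ∈ S ∧ y ≠ 0 ∧ ‖y‖ ≤ 101 / 100 * Metric.infDist (0 : EuclideanSpace ℝ (Fin 3)) (S \ {0})}, dist y (t • A v) ≤ 1 / ((n : ℝ) + 1) * t))}).toReal ≤ 0 := by
      by_contra hcon'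
      have hcon := not_le.1 hcon'
      have hprod : 0 < κ * (1 / ((n : ℝ) + 1)) ^ 2 * (P {μ | ∃ S : Set (EuclideanSpace ℝ (Fin 3)), μ = (MeasureTheory.Measure.count : MeasureTheory.Measure (EuclideanSpace ℝ (Fin 3))).restrict S ∧ ¬ (∃ A : EuclideanSpace ℝ (Fin 3) ≃ₗᵢ[ℝ] EuclideanSpace ℝ (Fin 3), ∃ t : ℝ, 0 < t ∧ ∃ F : Set (EuclideanSpace ℝ (Fin 3)), (F = (↑(Summit.AtomisticToContinuum.Crystallization.Theorems.PalmUnimodularRigidity.LayeredLawsSelectHcp.refStar a₀ h₀) : Set (EuclideanSpace ℝ (Fin 3))) ∨ F = ((fun p : EuclideanSpace ℝ (Fin 3) => a₀ • p) '' (↑Literature.Geometry.DiscreteGeometry.fccKissingPattern : Set (EuclideanSpace ℝ (Fin 3))))) ∧ (∀ y ∈ {y : EuclideanSpace ℝ (Fin 3) | y ∈ S ∧ y ≠ 0 ∧ ‖y‖ ≤ 101 / 100 * Metric.infDist (0 : EuclideanSpace ℝ (Fin 3)) (S \ {0})}, ∃ v ∈ F, dist y (t • A v) ≤ 1 / ((n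 : ℝ) + 1) * t) ∧ (∀ v ∈ F, ∃ y ∈ {y : EuclideanSpace ℝ (Fin 3) | y ∈ S ∧ y ≠ 0 ∧ ‖y‖ ≤ 101 / 100 * Metric.infDist (0 : EuclideanSpace ℝ (Fin 3)) (S \ {0})}, dist y (t • A v) ≤ 1 / ((n : ℝ) + 1) * t))}).toReal * (∫ μ, (∫ y, (‖y‖⁻¹) ^ 12 ∂μ) ∂P) :=
        mul_pos (mul_pos (mul_pos hκ (by positivity)) hcon) hS12
      linarith
    have h4 : (P {μ | ∃ S : Set (EuclideanSpace ℝ (Fin 3)), μ = (MeasureTheory.Measure.count : MeasureTheory.Measure (EuclideanSpace ℝ (Fin 3))).restrict S ∧ ¬ (∃ A : EuclideanSpace ℝ (Fin 3) ≃ₗᵢ[ℝ] EuclideanSpace ℝ (Fin 3), ∃ t : ℝ, 0 < t ∧ ∃ F : Set (EuclideanSpace ℝ (Fin 3)), (F = (↑(Summit.AtomisticToContinuum.Crystallization.Theorems.PalmUnimodularRigidity.LayeredLawsSelectHcp.refStar a₀ h₀) : Set (EuclideanSpace ℝ (Fin 3))) ∨ F = ((fun p : EuclideanSpace ℝ (Fin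 3) => a₀ • p) '' (↑Literature.Geometry.DiscreteGeometry.fccKissingPattern : Set (EuclideanSpace ℝ (Fin 3))))) ∧ (∀ y ∈ {y : EuclideanSpace ℝ (Fin 3) | y ∈ S ∧ y ≠ 0 ∧ ‖y‖ ≤ 101 / 100 * Metric.infDist (0 : EuclideanSpace ℝ (Fin 3)) (S \ {0})}, ∃ v ∈ F, dist y (t • A v) ≤ 1 / ((n : ℝ) + 1) * t) ∧ (∀ v ∈ F, ∃ y ∈ {y : EuclideanSpace ℝ (Fin 3) | y ∈ S ∧ y ≠ 0 ∧ ‖y‖ ≤ 101 / 100 * Metric.infDist (0 : EuclideanSpace ℝ (Fin 3)) (S \ {0})}, dist y (t • A v) ≤ 1 / ((n : ℝ) + 1) * t))}).toReal = 0 := le_antisymm h3 ENNReal.toReal_nonneg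
    exact (ENNReal.toReal_eq_zero_iff _).1 h4 |>.resolve_right (MeasureTheory.measure_ne_top P _)
  -- a.s. the root star is similarity-matched to a two-type reference star at every tolerance `1/(n+1)`
  have hae : ∀ᵐ μ ∂P, ∀ n : ℕ, μ ∉ {μ | ∃ S : Set (EuclideanSpace ℝ (Fin 3)), μ = (MeasureTheory.Measure.count : MeasureTheory.Measure (EuclideanSpace ℝ (Fin 3))).restrict S ∧ ¬ (∃ A : EuclideanSpace ℝ (Fin 3) ≃ₗᵢ[ℝ] EuclideanSpace ℝ (Fin 3), ∃ t : ℝ, 0 < t ∧ ∃ F : Set (EuclideanSpace ℝ (Fin 3)), (F = (↑(Summit.AtomisticToContinuum.Crystallization.Theorems.PalmUnimodularRigidity.LayeredLawsSelectHcp.refStar a₀ h₀) : Set (EuclideanSpace ℝ (Fin 3))) ∨ F = ((fun p : EuclideanSpace ℝ (Fin 3) => a₀ • p) '' (↑Literature.Geometry.DiscreteGeometry.fccKissingPattern : Set (EuclideanSpace ℝ (Fin 3))))) ∧ (∀ y ∈ {y : EuclideanSpace ℝ (Fin 3) | y ∈ S ∧ y ≠ 0 ∧ ‖y‖ ≤ 101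 / 100 * Metric.infDist (0 : EuclideanSpace ℝ (Fin 3)) (S \ {0})}, ∃ v ∈ F, dist y (t • A v) ≤ 1 / ((n : ℝ) + 1) * t) ∧ (∀ v ∈ F, ∃ y ∈ {y : EuclideanSpace ℝ (Fin 3) | y ∈ S ∧ y ≠ 0 ∧ ‖y‖ ≤ 101 / 100 * Metric.infDist (0 : EuclideanSpace ℝ (Fin 3)) (S \ {0})}, dist y (t • A v) ≤ 1 / ((n : ℝ) + 1) * t))} :=
    MeasureTheory.ae_all_iff.2 fun n => (MeasureTheory.measure_eq_zero_iff_ae_notMem).1 (hnull n)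
  have hroot : ∀ᵐ μ ∂P, ∀ n : ℕ, ∀ S' : Set (EuclideanSpace ℝ (Fin 3)), μ = (MeasureTheory.Measure.count : MeasureTheory.Measure (EuclideanSpace ℝ (Fin 3))).restrict S' → (∃ A : EuclideanSpace ℝ (Fin 3) ≃ₗᵢ[ℝ] EuclideanSpace ℝ (Fin 3), ∃ t : ℝ, 0 < t ∧ ∃ F : Set (EuclideanSpace ℝ (Fin 3)), (F = (↑(Summit.AtomisticToContinuum.Crystallization.Theorems.PalmUnimodularRigidity.LayeredLawsSelectHcp.refStar a₀ h₀) : Set (EuclideanSpace ℝ (Fin 3))) ∨ F = ((fun p : EuclideanSpace ℝ (Fin 3) => a₀ • p) '' (↑Literature.Geometry.DiscreteGeometry.fccKissingPattern : Set (EuclideanSpace ℝ (Fin 3))))) ∧ (∀ y ∈ {y : EuclideanSpace ℝ (Fin 3) | y ∈ S' ∧ y ≠ 0 ∧ ‖y‖ ≤ 101 / 100 * Metric.infDist (0 : EuclideanSpace ℝ (Fin 3)) (S' \ {0})}, ∃ v ∈ F, dist y (t • A v) ≤ 1 / ((n : ℝ) + 1) * t) ∧ (∀ v ∈ F, ∃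 y ∈ {y : EuclideanSpace ℝ (Fin 3) | y ∈ S' ∧ y ≠ 0 ∧ ‖y‖ ≤ 101 / 100 * Metric.infDist (0 : EuclideanSpace ℝ (Fin 3)) (S' \ {0})}, dist y (t • A v) ≤ 1 / ((n : ℝ) + 1) * t)) := by
    filter_upwards [hae] with μ hμ n S' hS'
    by_contra hc
    exact hμ n ⟨S', hS', hc⟩
  -- hard-core configurations are locally finite
  have hlf : ∀ᵐ μ ∂P, ∀ n : ℕ,
      μ ((fun z : EuclideanSpace ℝ (Fin 3) => ⌊‖z‖⌋₊) ⁻¹' {n}) < ⊤ := by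
    filter_upwards [hcore] with μ hμ n
    obtain ⟨S, -, hsep, rfl⟩ := hμ
    exact count_restrict_floorNorm_preimage_lt_top hδ hsep n
  -- everything shows at the root (Aldous–Lyons)
  have hall := ae_forall_map_sub_of_ae hstat hlf hroot
  -- a.s. the configuration is a DILATED exact rotated Barlow stacking with `h ∈ {h₀, a₀√(2/3)}`
  have hstack : (∀ᵐ μ ∂P, ∃ t : ℝ, 0 < t ∧ ∃ A : EuclideanSpace ℝ (Fin 3) ≃ₗᵢ[ℝ] EuclideanSpace ℝ (Fin 3), ∃ h : ℝ, (h = h₀ ∨ h = a₀ * Real.sqrt (2 / 3)) ∧ ∃ s : ℤ → ℤ, Literature.MathematicalPhysics.StatisticalMechanics.IsHaggSeq s ∧ μ = (MeasureTheory.Measure.count : MeasureTheory.Measure (EuclideanSpace ℝ (Fin 3))).restrict ((fun z : EuclideanSpace ℝ (Fin 3) => t • z) '' (A '' Literature.MathematicalPhysics.StatisticalMechanics.barlowStacking a₀ h s))) := by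
    filter_upwards [hcore, hgood, hall] with μ hc hg ha
    obtain ⟨S, h0, hsep, rfl⟩ := hc
    obtain ⟨S₁, hS₁, hg1⟩ := hg
    obtain rfl := eq_of_count_restrict_eq hS₁
    have hmatch : ∀ x ∈ S, ∀ n : ℕ, ∃ A : EuclideanSpace ℝ (Fin 3) ≃ₗᵢ[ℝ] EuclideanSpace ℝ (Fin 3), ∃ t : ℝ, 0 < t ∧ ∃ F : Set (EuclideanSpace ℝ (Fin 3)), (F = (↑(Summit.AtomisticToContinuum.Crystallization.Theorems.PalmUnimodularRigidity.LayeredLawsSelectHcp.refStar a₀ h₀) : Set (EuclideanSpace ℝ (Fin 3))) ∨ F = ((fun p : EuclideanSpace ℝ (Fin 3) => a₀ • p) '' (↑Literature.Geometry.DiscreteGeometry.fccKissingPattern : Set (EuclideanSpace ℝ (Fin 3))))) ∧ (∀ y ∈ {y : EuclideanSpace ℝ (Fin 3) | y ∈ ((fun p : EuclideanSpace ℝ (Fin 3) => p - x) '' S) ∧ y ≠ 0 ∧ ‖y‖ ≤ 101 / 100 * Metric.infDist (0 : EuclideanSpace ℝ (Fin 3)) (((fun p : EuclideanSpace ℝ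 (Fin 3) => p - x) '' S) \ {0})}, ∃ v ∈ F, dist y (t • A v) ≤ 1 / ((n : ℝ) + 1) * t) ∧ (∀ v ∈ F, ∃ y ∈ {y : EuclideanSpace ℝ (Fin 3) | y ∈ ((fun p : EuclideanSpace ℝ (Fin 3) => p - x) '' S) ∧ y ≠ 0 ∧ ‖y‖ ≤ 101 / 100 * Metric.infDist (0 : EuclideanSpace ℝ (Fin 3)) (((fun p : EuclideanSpace ℝ (Fin 3) => p - x) '' S) \ {0})}, dist y (t • A v) ≤ 1 / ((n : ℝ) + 1) * t) := fun x hx n =>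
      ha x ((count_restrict_singleton_ne_zero_iff S x).2 hx) n _ (map_sub_count_restrict S x)
    obtain ⟨t, ht, S', hSS', h0', hstar'⟩ :=
      PricedHcpWindowsSimilarStarNormalisation.stub_similarStarNormalisation a₀ h₀ hb1 hb2 hb3 hb4 hglob δ hδ S h0 hsep hg1 hmatch
    obtain ⟨A, h, hh, s', hs', hS'eq⟩ := PricedHcpWindowsExactStars.exactStarRigidity a₀ h₀ hb1 hb2 hb3 hb4 S' h0' hstar'
    exact ⟨t, ht, A, h, hh, s', hs', by rw [hSS', hS'eq]⟩
  -- the dilation is `1` (V6), then selection at exact geometry (X3, landed): a.s. an exact rotated `hcpStacking a₀ h₀`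
  have hpin := PricedHcpWindowsDilationPinning.stub_dilationPinning a₀ h₀ hb1 hb2 hb3 hb4 hglob δ hδ P hP hcore hstat hstack hle
  have hexact : ∀ᵐ μ ∂P, ∃ A : EuclideanSpace ℝ (Fin 3) ≃ₗᵢ[ℝ] EuclideanSpace ℝ (Fin 3), μ = (MeasureTheory.Measure.count : MeasureTheory.Measure (EuclideanSpace ℝ (Fin 3))).restrict (A '' Literature.MathematicalPhysics.StatisticalMechanics.hcpStacking a₀ h₀) :=
    PalmGoodLaw.ExactSelectionLaw.stub_exactSelectionLaw a₀ h₀ hb1 hb2 hb3 hb4 hglob δ hδ P hP hcore hstat hle hpin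
  -- an a.s. event has non-zero measure; an exact rotated net is matched at every `(R, θ)`
  intro h0
  have hnot : ∀ᵐ μ ∂P, μ ∉ {μ | ∃ S : Set (EuclideanSpace ℝ (Fin 3)), μ = (MeasureTheory.Measure.count : MeasureTheory.Measure (EuclideanSpace ℝ (Fin 3))).restrict S ∧ ∃ A : EuclideanSpace ℝ (Fin 3) ≃ₗᵢ[ℝ] EuclideanSpace ℝ (Fin 3), (∀ y ∈ S, ‖y‖ ≤ R → ∃ z ∈ Literature.MathematicalPhysics.StatisticalMechanics.hcpStacking a₀ h₀, dist y (A z) ≤ θ) ∧ (∀ z ∈ Literature.MathematicalPhysics.StatisticalMechanics.hcpStacking a₀ h₀, ‖z‖ ≤ R → ∃ y ∈ S, dist y (A z) ≤ θ)} :=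
    (MeasureTheory.measure_eq_zero_iff_ae_notMem).1 h0
  haveI : (MeasureTheory.ae P).NeBot := MeasureTheory.ae_neBot.2 (IsProbabilityMeasure.ne_zero P)
  obtain ⟨μ, ⟨A, rfl⟩, hμ⟩ := (hexact.and hnot).exists
  refine hμ ⟨A '' Literature.MathematicalPhysics.StatisticalMechanics.hcpStacking a₀ h₀, rfl, A, ?_, ?_⟩
  · rintro y ⟨z, hz, rfl⟩ _
    exact ⟨z, hz, by simp [hθ.le]⟩
  · intro z hz _
    exact ⟨A z, ⟨z, hz, rfl⟩, by simp [hθ.le]⟩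

/-- **stub_stackingHingeOfShapeRatioFloor** (registered glue stub of `Lines/Sketch.lean` v40, verbatim): `ShapeRatioFloor →
SoftLayerPropagation → ChargeFreeWindows → GroundStatesChargePeriodic` (the crux with its definition unfolded), by
`supportCore_of_shapeRatioFloor` and the landed `PricedHcpWindowsSupportCore.stub_gscpOfSupportCore` (p145881). [folklore] -/
theorem stub_stackingHingeOfShapeRatioFloor : (∀ a₀ h₀ : ℝ, 189 / 200 ≤ a₀ → a₀ ≤ 199 / 200 → 77 / 100 ≤ h₀ → h₀ ≤ 163 / 200 → (∀ a h : ℝ, 0 < a → 0 < h → Summit.AtomisticToContinuum.Crystallization.Theorems.PalmUnimodularRigidity.LayeredLawsSelectHcp.hcpE a₀ h₀ ≤ Summit.AtomisticToContinuum.Crystallization.Theorems.PalmUnimodularRigidity.LayeredLawsSelectHcp.hcpE a h) → ∀ δ : ℝ, 0 < δ → ∃ κ : ℝ, 0 < κ ∧ ∀ P : MeasureTheory.Measure (MeasureTheory.Measure (EuclideanSpace ℝ (Fin 3))), MeasureTheory.IsProbabilityMeasure P → (∀ᵐ μ ∂P, (∃ S : Set (EuclideanSpace ℝ (Fin 3)),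 (0 : EuclideanSpace ℝ (Fin 3)) ∈ S ∧ (∀ x ∈ S, ∀ y ∈ S, x ≠ y → δ ≤ dist x y) ∧ μ = (MeasureTheory.Measure.count : MeasureTheory.Measure (EuclideanSpace ℝ (Fin 3))).restrict S)) → (∀ g : MeasureTheory.Measure (EuclideanSpace ℝ (Fin 3)) → EuclideanSpace ℝ (Fin 3) → ENNReal, Measurable (Function.uncurry g) → ∫⁻ μ, ∫⁻ y, g μ y ∂μ ∂P = ∫⁻ μ, ∫⁻ y, g (MeasureTheory.Measure.map (fun z => z - y) μ) (-y) ∂μ ∂P) → (∀ᵐ μ ∂P, ∃ S : Set (EuclideanSpace ℝ (Fin 3)), μ = (MeasureTheory.Measure.count : MeasureTheory.Measure (EuclideanSpace ℝ (Fin 3))).restrict S ∧ ∀ x ∈ S, (∀ t r : ℝ, Metric.infDist x (S \ {x}) / 6 < t → r < 3 * Metric.infDist x (S \ {x}) → ∃ s : ℤ → ℤ, Literature.MathematicalPhysics.StatisticalMechanics.IsHaggSeq s ∧ ∃ g : EuclideanSpace ℝ (Fin 3) ≃ᵃⁱ[ℝ] EuclideanSpace ℝ (Fin 3), (∀ y ∈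 S, dist x y ≤ r → ∃ z ∈ Literature.MathematicalPhysics.StatisticalMechanics.barlowStacking (Metric.infDist x (S \ {x})) (Metric.infDist x (S \ {x}) * Real.sqrt (2 / 3)) s, dist y (g z) ≤ t) ∧ (∀ z ∈ Literature.MathematicalPhysics.StatisticalMechanics.barlowStacking (Metric.infDist x (S \ {x})) (Metric.infDist x (S \ {x}) * Real.sqrt (2 / 3)) s, dist x (g z) ≤ r → ∃ y ∈ S, dist y (g z) ≤ t)) ∧ ((∀ y ∈ S, y ≠ x → dist x y < 107 / 100 * Metric.infDist x (S \ {x}) → dist x y ≤ 101 / 100 * Metric.infDist x (S \ {x})) ∧ ∃ T : Finset (EuclideanSpace ℝ (Fin 3)), (↑T : Set (EuclideanSpace ℝ (Fin 3))) ⊆ {y : EuclideanSpace ℝ (Fin 3) | y ∈ S ∧ y ≠ x ∧ dist x y ≤ 101 / 100 * Metric.infDist x (S \ {x})} ∧ T.card = 12)) → ∀ θ : ℝ, 0 < θ → θ ≤ 1 → (∫ μ, (∫ y, (‖y‖⁻¹) ^ 6 ∂μ) ∂P) ^ 2 + κ * θ ^ 2 * (P {μ | ∃ S : Set (EuclideanSpace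 ℝ (Fin 3)), μ = (MeasureTheory.Measure.count : MeasureTheory.Measure (EuclideanSpace ℝ (Fin 3))).restrict S ∧ ¬ (∃ A : EuclideanSpace ℝ (Fin 3) ≃ₗᵢ[ℝ] EuclideanSpace ℝ (Fin 3), ∃ t : ℝ, 0 < t ∧ ∃ F : Set (EuclideanSpace ℝ (Fin 3)), (F = (↑(Summit.AtomisticToContinuum.Crystallization.Theorems.PalmUnimodularRigidity.LayeredLawsSelectHcp.refStar a₀ h₀) : Set (EuclideanSpace ℝ (Fin 3))) ∨ F = ((fun p : EuclideanSpace ℝ (Fin 3) => a₀ • p) '' (↑Literature.Geometry.DiscreteGeometry.fccKissingPattern : Set (EuclideanSpace ℝ (Fin 3))))) ∧ (∀ y ∈ {y : EuclideanSpace ℝ (Fin 3) | y ∈ S ∧ y ≠ 0 ∧ ‖y‖ ≤ 101 / 100 * Metric.infDist (0 : EuclideanSpace ℝ (Fin 3)) (S \ {0})}, ∃ v ∈ F, dist y (t • A v) ≤ θ * t) ∧ (∀ v ∈ F, ∃ y ∈ {y : EuclideanSpace ℝ (Fin 3) | y ∈ S ∧ y ≠ 0 ∧ ‖y‖ ≤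 101 / 100 * Metric.infDist (0 : EuclideanSpace ℝ (Fin 3)) (S \ {0})}, dist y (t • A v) ≤ θ * t))}).toReal * (∫ μ, (∫ y, (‖y‖⁻¹) ^ 12 ∂μ) ∂P) ≤ (-24 * Summit.AtomisticToContinuum.Crystallization.Theorems.PalmUnimodularRigidity.LayeredLawsSelectHcp.hcpE a₀ h₀) * (∫ μ, (∫ y, (‖y‖⁻¹) ^ 12 ∂μ) ∂P)) → Summit.AtomisticToContinuum.Crystallization.Theses.PricedLinkCensus.SoftLayerPropagation → Summit.AtomisticToContinuum.Crystallization.Theses.PricedLinkCensus.ChargeFreeWindows → Summit.AtomisticToContinuum.Crystallization.Theses.PricedLinkCensus.GroundStatesChargePeriodic :=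
  fun hV2 => PricedHcpWindowsSupportCore.stub_gscpOfSupportCore (supportCore_of_shapeRatioFloor hV2)

/-- **THE ONE-LINE CLOSER from the shape floor**: `ShapeRatioFloor → StackingHinge`. [folklore] -/
theorem stackingHinge_of_shapeRatioFloor (hV2 : ∀ a₀ h₀ : ℝ, 189 / 200 ≤ a₀ → a₀ ≤ 199 / 200 → 77 / 100 ≤ h₀ → h₀ ≤ 163 / 200 → (∀ a h : ℝ, 0 < a → 0 < h → Summit.AtomisticToContinuum.Crystallization.Theorems.PalmUnimodularRigidity.LayeredLawsSelectHcp.hcpE a₀ h₀ ≤ Summit.AtomisticToContinuum.Crystallization.Theorems.PalmUnimodularRigidity.LayeredLawsSelectHcp.hcpE a h) → ∀ δ : ℝ, 0 < δ → ∃ κ : ℝ, 0 < κ ∧ ∀ P : MeasureTheory.Measure (MeasureTheory.Measure (EuclideanSpace ℝ (Fin 3))), MeasureTheory.IsProbabilityMeasure P → (∀ᵐ μ ∂P, (∃ S : Set (EuclideanSpace ℝ (Fin 3)), (0 : EuclideanSpace ℝ (Fin 3)) ∈ S ∧ (∀ x ∈ S, ∀ y ∈ S, x ≠ y → δ ≤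 dist x y) ∧ μ = (MeasureTheory.Measure.count : MeasureTheory.Measure (EuclideanSpace ℝ (Fin 3))).restrict S)) → (∀ g : MeasureTheory.Measure (EuclideanSpace ℝ (Fin 3)) → EuclideanSpace ℝ (Fin 3) → ENNReal, Measurable (Function.uncurry g) → ∫⁻ μ, ∫⁻ y, g μ y ∂μ ∂P = ∫⁻ μ, ∫⁻ y, g (MeasureTheory.Measure.map (fun z => z - y) μ) (-y) ∂μ ∂P) → (∀ᵐ μ ∂P, ∃ S : Set (EuclideanSpace ℝ (Fin 3)), μ = (MeasureTheory.Measure.count : MeasureTheory.Measure (EuclideanSpace ℝ (Fin 3))).restrict S ∧ ∀ x ∈ S, (∀ t r : ℝ, Metric.infDist x (S \ {x}) / 6 < t → r < 3 * Metric.infDist x (S \ {x}) → ∃ s : ℤ → ℤ, Literature.MathematicalPhysics.StatisticalMechanics.IsHaggSeq s ∧ ∃ g : EuclideanSpace ℝ (Fin 3) ≃ᵃⁱ[ℝ] EuclideanSpace ℝ (Fin 3), (∀ y ∈ S, dist x y ≤ r → ∃ z ∈ Literature.MathematicalPhysics.StatisticalMechanics.barlowStacking (Metric.infDist x (S \ {x}))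 (Metric.infDist x (S \ {x}) * Real.sqrt (2 / 3)) s, dist y (g z) ≤ t) ∧ (∀ z ∈ Literature.MathematicalPhysics.StatisticalMechanics.barlowStacking (Metric.infDist x (S \ {x})) (Metric.infDist x (S \ {x}) * Real.sqrt (2 / 3)) s, dist x (g z) ≤ r → ∃ y ∈ S, dist y (g z) ≤ t)) ∧ ((∀ y ∈ S, y ≠ x → dist x y < 107 / 100 * Metric.infDist x (S \ {x}) → dist x y ≤ 101 / 100 * Metric.infDist x (S \ {x})) ∧ ∃ T : Finset (EuclideanSpace ℝ (Fin 3)), (↑T : Set (EuclideanSpace ℝ (Fin 3))) ⊆ {y : EuclideanSpace ℝ (Fin 3) | y ∈ S ∧ y ≠ x ∧ dist x y ≤ 101 / 100 * Metric.infDist x (S \ {x})} ∧ T.card = 12)) → ∀ θ : ℝ, 0 < θ → θ ≤ 1 → (∫ μ, (∫ y, (‖y‖⁻¹) ^ 6 ∂μ) ∂P) ^ 2 + κ * θ ^ 2 * (P {μ | ∃ S : Set (EuclideanSpace ℝ (Fin 3)), μ = (MeasureTheory.Measure.count : MeasureTheory.Measure (EuclideanSpace ℝ (Fin 3))).restrict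 S ∧ ¬ (∃ A : EuclideanSpace ℝ (Fin 3) ≃ₗᵢ[ℝ] EuclideanSpace ℝ (Fin 3), ∃ t : ℝ, 0 < t ∧ ∃ F : Set (EuclideanSpace ℝ (Fin 3)), (F = (↑(Summit.AtomisticToContinuum.Crystallization.Theorems.PalmUnimodularRigidity.LayeredLawsSelectHcp.refStar a₀ h₀) : Set (EuclideanSpace ℝ (Fin 3))) ∨ F = ((fun p : EuclideanSpace ℝ (Fin 3) => a₀ • p) '' (↑Literature.Geometry.DiscreteGeometry.fccKissingPattern : Set (EuclideanSpace ℝ (Fin 3))))) ∧ (∀ y ∈ {y : EuclideanSpace ℝ (Fin 3) | y ∈ S ∧ y ≠ 0 ∧ ‖y‖ ≤ 101 / 100 * Metric.infDist (0 : EuclideanSpace ℝ (Fin 3)) (S \ {0})}, ∃ v ∈ F, dist y (t • A v) ≤ θ * t) ∧ (∀ v ∈ F, ∃ y ∈ {y : EuclideanSpace ℝ (Fin 3) | y ∈ S ∧ y ≠ 0 ∧ ‖y‖ ≤ 101 / 100 * Metric.infDist (0 : EuclideanSpace ℝ (Fin 3)) (S \ {0})}, dist y (t • A v) ≤ θ *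 t))}).toReal * (∫ μ, (∫ y, (‖y‖⁻¹) ^ 12 ∂μ) ∂P) ≤ (-24 * Summit.AtomisticToContinuum.Crystallization.Theorems.PalmUnimodularRigidity.LayeredLawsSelectHcp.hcpE a₀ h₀) * (∫ μ, (∫ y, (‖y‖⁻¹) ^ 12 ∂μ) ∂P)) :
    Summit.AtomisticToContinuum.Crystallization.Theses.PricedLinkCensus.StackingHinge :=
  fun hSLP hCFW => stub_stackingHingeOfShapeRatioFloor hV2 hSLP hCFW

end Summit.AtomisticToContinuum.Crystallization.Theorems.PricedHcpWindowsShapeRatioFloor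

end
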